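import Summits.AtomisticToContinuum.Crystallization.Theorems.FrustratedLawDichotomyStrainedPatchHomEntryHcpFrame

/-!
# The reflected hcp (P1) FIT prune, part 1: the real fit theorem for the hcp pattern and the kernel verdict `fitOKH`

decomp-a2c hand-2 g22 (crux `AperiodicFrustratedLawGap`, stmt-AtomisticToContinuum-27623; sequel of `…HomEntryFit` (fcc) and `…HomEntryHcpFrame`).  Near the
unstrained hcp crystal (`U ≈ λ·1`, `ξ ≈ 0`) the box floor (P4) is false at `m = 1/625`; the certificate must certify the centre `1/20`-GOOD for the hcp
PATTERN (`…HomPrunesFit.goodAtScale_centre_of_fit_hcpPattern`).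

* §1 ★★ `goodAtScale_of_fitBounds_hcp` (def-free real theorem; shuffles up to `‖ξ‖ ≤ 1/2`): the hcp twin of `…HomEntryFit.goodAtScale_of_fitBounds` — the
  twelve deformed neighbours `nbrU U ξ k`, two-sided bounds on `d = min_k ‖nbrU k‖`, the fit `‖nbrU k − ‖nbrU k'‖ • nbr k‖² ≤ η'² d2lo`, the clean gap, and the
  off-shell far bounds for BOTH families over `[−7,7]³` (index boxes `…HomLatticeBoxHcp.mem_box_of_norm_hexPt(_add_shift)_lt`) ⟹ `GoodAtScale (1/20) (3/2)` at
  the centre of every locally `U·(L_A ∪ (L_A + hcpShift + ξ))` ball; isometry from `…HomEntryHcpFrame.exists_hcpIso`, `t' u := nbrU U ξ k(u)`;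
* §2 the kernel side over the 13 extended Gram intervals `…HomEntryGramHcp.extFI` of `U` (`extU`) and of the deviation `V = U − λ·1` (`extV`, `λ = scaleL`):
  `qform13` (+ `mem_qform13`), `mem_extFI`, `nbrSq`, `devSqH`, `dSqH / dEnclH`, `devMaxH`, `xiSq`, `misfitH = 6ρ² + 12λ²‖ξ‖²`, and ★ the verdict `fitOKH c w`.
Soundness, the combined verdict and `homFloor_of_entryFitTrees` are the sequel `…HomEntryFitHcp`.

All definitions computable; 0 sorry; standard axioms; no instances / notation.  `--supports stmt-AtomisticToContinuum-27623`.
-/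

namespace Summit.AtomisticToContinuum.Crystallization.Theorems.FrustratedLawDichotomyStrainedPatchHomEntryFitHcpKit

open scoped BigOperators RealInnerProductSpace
open Literature.Analysis.ValidatedNumerics.Numerics
open Literature.Geometry.DiscreteGeometry (hcpKissingPattern)
open Literature.Geometry.DiscreteGeometry.ShellCensus (hcpTuple hcpTuple_injective)
open Summit.AtomisticToContinuum.Crystallization.Theorems.ChargedEnergyGapNegative (E3)
open Summit.AtomisticToContinuum.Crystallization.Theorems.FrustratedLawDichotomySchurCut (effPot w₄₅ ω₄)
open Summit.AtomisticToContinuum.Crystallization.Theorems.FrustratedLawDichotomyMotifLemmas (GoodAtScale)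
open Summit.AtomisticToContinuum.Crystallization.Theorems.FrustratedLawDichotomyAveragingRuleTightFree (TightNearCap BadNearCap)
open Summit.AtomisticToContinuum.Crystallization.Theorems.FrustratedLawDichotomyExemptAbsorption (ExemptNear)
open Summit.AtomisticToContinuum.Crystallization.Theorems.FrustratedLawDichotomyStrainedPatchHomSplit
open Summit.AtomisticToContinuum.Crystallization.Theorems.FrustratedLawDichotomyStrainedPatchHomGram (norm_sq_latPt_eq_sum_gram norm_sq_latPt_add_eq_sum_gram)
open Summit.AtomisticToContinuum.Crystallization.Theorems.FrustratedLawDichotomyStrainedPatchHomLatticeBox (norm_apply_ge_of_near_one latPt_zero)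
open Summit.AtomisticToContinuum.Crystallization.Theorems.FrustratedLawDichotomyStrainedPatchHomLatticeBoxHcp
  (latPt_eq_apply_one shifted_eq_apply mem_box_of_norm_hexPt_lt mem_box_of_norm_hexPt_add_shift_lt)
open Summit.AtomisticToContinuum.Crystallization.Theorems.FrustratedLawDichotomyStrainedPatchHomPrunesFit (goodAtScale_centre_of_fit_hcpPattern)
open Summit.AtomisticToContinuum.Crystallization.Theorems.FrustratedLawDichotomyAveragingCut (self_mem_ball)
open Summit.AtomisticToContinuum.Crystallization.Theorems.FrustratedLawDichotomyStrainedPatchHomPrunes (locHom_hcp_centre)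
open Summit.AtomisticToContinuum.Crystallization.Theorems.FrustratedLawDichotomyStrainedPatchHomPrunedPolar (homFloor_of_prunedBoxSums_selfAdjoint)
open Summit.AtomisticToContinuum.Crystallization.Theorems.FrustratedLawDichotomyStrainedPatchHomLeafCheckC (iccC iccC_eq)
open Summit.AtomisticToContinuum.Crystallization.Theorems.FrustratedLawDichotomyStrainedPatchHomCertTree (CertTree treeOK)
open Summit.AtomisticToContinuum.Crystallization.Theorems.FrustratedLawDichotomyStrainedPatchHomEntryGram
open Summit.AtomisticToContinuum.Crystallization.Theorems.FrustratedLawDichotomyStrainedPatchHomEntryFitKit (lmin lmin_le_of_mem lmin_mem)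
open Summit.AtomisticToContinuum.Crystallization.Theorems.FrustratedLawDichotomyStrainedPatchHomEntryFit (scaleL devFI entryLeafOKF fccHalf_of_entryFitTree lmax le_lmax_of_mem)
open Summit.AtomisticToContinuum.Crystallization.Theorems.FrustratedLawDichotomyStrainedPatchHomEntryGramHcp
open Summit.AtomisticToContinuum.Crystallization.Theorems.FrustratedLawDichotomyStrainedPatchHomEntryHcpFrame
open Summit.AtomisticToContinuum.Crystallization.Theorems.FrustratedLawDichotomyTwoShellRigidityAssemblyDial (hcpTuple_mem exists_hcpTuple_eq)

/-! ## §1. The real fit theorem, hcp pattern -/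

/-- ★★ **CENTRE `1/20`-GOOD (hcp PATTERN) FROM FIT BOUNDS** (def-free).  See the module docstring. [folklore] -/
theorem goodAtScale_of_fitBounds_hcp (U : E3 →L[ℝ] E3) (ξ : E3) (hU : ‖U - 1‖ ≤ 1 / 4) (hξ : ‖ξ‖ ≤ 1 / 2) {dlo dhi : ℝ} (hdlo : 0 < dlo)
    (hdhi : dhi ≤ 3 / 2)
    (hlo : ∀ k, dlo ≤ ‖nbrU U ξ k‖) (hhi : ∃ k, ‖nbrU U ξ k‖ ≤ dhi) {d2lo : ℝ} (hd2 : ∀ k, d2lo ≤ ‖nbrU U ξ k‖ ^ 2)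
    (hfit : ∀ k k', ‖nbrU U ξ k - ‖nbrU U ξ k'‖ • nbr k‖ ^ 2 ≤ (49 / 1000 : ℝ) ^ 2 * d2lo)
    (hcl : ∀ k, ‖nbrU U ξ k‖ ≤ 13 / 10 * dlo - 1 / 100)
    (hfarA : ∀ b ∈ (Fintype.piFinset fun _ : Fin 3 => Finset.Icc (-7 : ℤ) 7), b ≠ 0 → (∀ k, hshift k = false → hlab k ≠ b) →
      13 / 10 * dhi + 1 / 100 ≤ ‖latPt U hexFrame b‖)
    (hfarB : ∀ b ∈ (Fintype.piFinset fun _ : Fin 3 => Finset.Icc (-7 : ℤ) 7), (∀ k, hshift k = true → hlab k ≠ b) →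
      13 / 10 * dhi + 1 / 100 ≤ ‖latPt U hexFrame b + U (hcpShift + ξ)‖) :
    ∀ (M : ℕ) (z : Fin M → E3) (c : Fin M), Function.Injective z →
      (∀ x : E3, dist x (z c) < 15 / 2 → (x ∈ Set.range z ↔
        x - z c ∈ {v : E3 | ∃ b : Fin 3 → ℤ, v = latPt U hexFrame b ∨ v = latPt U hexFrame b + U (hcpShift + ξ)})) →
      GoodAtScale (1 / 20) (3 / 2) z c := by
  intro M z c _hz hT
  obtain ⟨k₀, -, hk₀⟩ := Finset.exists_min_image Finset.univ (fun k : Fin 12 => ‖nbrU U ξ k‖) Finset.univ_nonempty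
  have hd_le : ∀ k, ‖nbrU U ξ k₀‖ ≤ ‖nbrU U ξ k‖ := fun k => hk₀ k (Finset.mem_univ k)
  have hdlo_d : dlo ≤ ‖nbrU U ξ k₀‖ := hlo k₀
  have hd_dhi : ‖nbrU U ξ k₀‖ ≤ dhi := by obtain ⟨k, hk⟩ := hhi; exact (hd_le k).trans hk
  have hd0 : 0 < ‖nbrU U ξ k₀‖ := hdlo.trans_le hdlo_d
  obtain ⟨A, hA⟩ := exists_hcpIso
  -- the index of a pattern point
  have hk : ∀ u : ↥hcpKissingPattern, ∃ k : Fin 12, hcpTuple k = (u : E3) := fun u => exists_hcpTuple_eq u.2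
  choose kOf hkOf using hk
  -- both families are short only on the twelve labels
  have hshortA : ∀ b : Fin 3 → ℤ, latPt U hexFrame b ≠ 0 → ‖latPt U hexFrame b‖ < 13 / 10 * ‖nbrU U ξ k₀‖ + 1 / 100 →
      ∃ k, hshift k = false ∧ hlab k = b := by
    intro b hb0 hlt
    by_cases hex : ∃ k, hshift k = false ∧ hlab k = b
    · exact hex
    · exfalso
      have hb : b ≠ 0 := by rintro rfl; exact hb0 (latPt_zero U hexFrame)
      have h34 := norm_apply_ge_of_near_one hU (latPt 1 hexFrame b)
      rw [← latPt_eq_apply_one] at h34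
      have hbox := mem_box_of_norm_hexPt_lt (b := b) (by linarith)
      have := hfarA b hbox hb (fun k hk he => hex ⟨k, hk, he⟩)
      linarith
  have hshortB : ∀ b : Fin 3 → ℤ, ‖latPt U hexFrame b + U (hcpShift + ξ)‖ < 13 / 10 * ‖nbrU U ξ k₀‖ + 1 / 100 →
      ∃ k, hshift k = true ∧ hlab k = b := by
    intro b hlt
    by_cases hex : ∃ k, hshift k = true ∧ hlab k = b
    · exact hex
    · exfalso
      have h34 := norm_apply_ge_of_near_one hU (latPt 1 hexFrame b + hcpShift + ξ)
      rw [← shifted_eq_apply] at h34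
      have htri : ‖latPt 1 hexFrame b + hcpShift‖ ≤ ‖latPt 1 hexFrame b + hcpShift + ξ‖ + ‖ξ‖ := by
        have := norm_sub_le (latPt 1 hexFrame b + hcpShift + ξ) ξ
        simpa using this
      have hbox := mem_box_of_norm_hexPt_add_shift_lt (b := b) (by linarith)
      have := hfarB b hbox (fun k hk he => hex ⟨k, hk, he⟩)
      linarith
  refine goodAtScale_centre_of_fit_hcpPattern hT (d := ‖nbrU U ξ k₀‖) (η' := 49 / 1000) (γ := 1 / 100) (A := A)
    (t' := fun u => nbrU U ξ (kOf u)) (hd_dhi.trans hdhi) hd0 (by norm_num) (by norm_num) (by linarith) ?_ ?_ ?_ ?_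
  · -- (hfit)
    intro u
    refine ⟨nbrU_mem U ξ (kOf u), by linarith [hcl (kOf u), hlo (kOf u)], ?_⟩
    have g := hfit (kOf u) k₀
    have h2 := hd2 k₀
    have hsq : ‖nbrU U ξ (kOf u) - ‖nbrU U ξ k₀‖ • nbr (kOf u)‖ ^ 2 ≤ (49 / 1000 * ‖nbrU U ξ k₀‖) ^ 2 := by linarith
    show ‖nbrU U ξ (kOf u) - ‖nbrU U ξ k₀‖ • A (u : E3)‖ ≤ 49 / 1000 * ‖nbrU U ξ k₀‖
    rw [← hkOf u, hA]
    exact (abs_le_of_sq_le_sq' hsq (by positivity)).2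
  · -- (hlow)
    rintro w ⟨b, hb⟩ hw0 hlt
    rcases hb with rfl | rfl
    · obtain ⟨k, hk, rfl⟩ := hshortA b hw0 hlt
      rw [← nbrU_of_unshifted (U := U) (ξ := ξ) hk]; exact hd_le k
    · obtain ⟨k, hk, rfl⟩ := hshortB b hlt
      rw [← nbrU_of_shifted (U := U) (ξ := ξ) hk]; exact hd_le k
  · -- (hex)
    refine ⟨nbrU U ξ k₀, nbrU_mem U ξ k₀, fun h0 => ?_, le_rfl⟩
    rw [h0, norm_zero] at hd0
    exact lt_irrefl _ hd0
  · -- (hclean)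
    rintro w ⟨b, hb⟩ hw0 hlt
    have key : ∀ k, w = nbrU U ξ k → ‖w‖ ≤ 13 / 10 * ‖nbrU U ξ k₀‖ - 1 / 100 ∧ w ∈ Set.range (fun u : ↥hcpKissingPattern => nbrU U ξ (kOf u)) := by
      rintro k rfl
      refine ⟨by linarith [hcl k], ⟨⟨hcpTuple k, hcpTuple_mem k⟩, ?_⟩⟩
      have e : kOf ⟨hcpTuple k, hcpTuple_mem k⟩ = k := hcpTuple_injective (hkOf ⟨hcpTuple k, hcpTuple_mem k⟩)
      simp only [e]
    rcases hb with rfl | rfl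
    · obtain ⟨k, hk, rfl⟩ := hshortA b hw0 hlt
      exact key k (nbrU_of_unshifted hk).symm
    · obtain ⟨k, hk, rfl⟩ := hshortB b hlt
      exact key k (nbrU_of_shifted hk).symm

/-! ## §2. The kernel verdict -/

/-- The computable index box `[−7,7]³` (with `0`), via `…HomLeafCheckC.iccC`. -/
def box7all : Finset (Fin 3 → ℤ) := Fintype.piFinset fun _ : Fin 3 => iccC

/-- `box7all = [−7,7]³`. [formal bookkeeping] -/
theorem box7all_eq : box7all = Fintype.piFinset fun _ : Fin 3 => Finset.Icc (-7 : ℤ) 7 := by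
  unfold box7all; rw [iccC_eq]

/-- Extended quadratic form of the label `(b, s)`: `Σᵢⱼ bᵢbⱼ T(i,j) + [s](2 Σᵢ bᵢ T(i,t) + T(t,t))` over 13 intervals. -/
def qform13 (T : (Fin 3 × Fin 3) ⊕ (Fin 3 ⊕ Fin 1) → FI) (b : Fin 3 → ℤ) (s : Bool) : FI :=
  let G := FrustratedLawDichotomyStrainedPatchHomEntryFitKit.qformFI (fun i j => T (Sum.inl (i, j))) b
  if s then
    (G.add (((((T (Sum.inr (Sum.inl 0))).mulInt (b 0)).add ((T (Sum.inr (Sum.inl 1))).mulInt (b 1))).add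
      ((T (Sum.inr (Sum.inl 2))).mulInt (b 2))).mulInt 2)).add (T (Sum.inr (Sum.inr 0)))
  else G

/-- ★ `qform13` encloses `‖latPt W hexFrame b (+ W t)‖²` when `T` encloses the 13 extended Gram data of `(W, t)`. [folklore] -/
theorem mem_qform13 (W : E3 →L[ℝ] E3) (t : E3) {T : (Fin 3 × Fin 3) ⊕ (Fin 3 ⊕ Fin 1) → FI}
    (hG : ∀ i j, FI.mem ⟪W (hexFrame i), W (hexFrame j)⟫ (T (Sum.inl (i, j))))
    (hC : ∀ i, FI.mem ⟪W (hexFrame i), W t⟫ (T (Sum.inr (Sum.inl i)))) (hT : FI.mem (‖W t‖ ^ 2) (T (Sum.inr (Sum.inr 0))))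
    (b : Fin 3 → ℤ) (s : Bool) :
    FI.mem (‖latPt W hexFrame b + if s then W t else 0‖ ^ 2) (qform13 T b s) := by
  cases s
  · simp only [Bool.false_eq_true, ↓reduceIte, add_zero, qform13]
    rw [norm_sq_latPt_eq_sum_gram]
    exact FrustratedLawDichotomyStrainedPatchHomEntryFitKit.mem_qformFI hG b
  · simp only [↓reduceIte, qform13]
    rw [norm_sq_latPt_add_eq_sum_gram]
    have e : (2 : ℝ) * ∑ i : Fin 3, (b i : ℝ) * ⟪W (hexFrame i), W t⟫ =
        (⟪W (hexFrame 0), W t⟫ * ((b 0 : ℤ) : ℝ) + ⟪W (hexFrame 1), W t⟫ * ((b 1 : ℤ) : ℝ) + ⟪W (hexFrame 2), W t⟫ * ((b 2 : ℤ) : ℝ)) *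
          ((2 : ℤ) : ℝ) := by
      simp only [Fin.sum_univ_three]; push_cast; ring
    rw [e]
    exact FI.mem_add (FI.mem_add (FrustratedLawDichotomyStrainedPatchHomEntryFitKit.mem_qformFI hG b)
      (FI.mem_mulInt (FI.mem_add (FI.mem_add (FI.mem_mulInt (hC 0) _) (FI.mem_mulInt (hC 1) _)) (FI.mem_mulInt (hC 2) _)) 2)) hT

/-- ★ The 13 extended Gram data of `(W, hcpShift + ξ)` lie in `extFI E X` when the entries of `W` lie in `E` and `ξ` in `X`. [formal bookkeeping] -/
theorem mem_extFI (W : E3 →L[ℝ] E3) (ξ : E3) {E : Fin 3 × Fin 3 → FI} {X : Fin 3 → FI}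
    (hE : ∀ ab : Fin 3 × Fin 3, FI.mem ((W (EuclideanSpace.single ab.2 (1 : ℝ))) ab.1) (E ab)) (hX : ∀ i, FI.mem (ξ i) (X i)) :
    (∀ i j, FI.mem ⟪W (hexFrame i), W (hexFrame j)⟫ (extFI E X (Sum.inl (i, j)))) ∧
    (∀ i, FI.mem ⟪W (hexFrame i), W (hcpShift + ξ)⟫ (extFI E X (Sum.inr (Sum.inl i)))) ∧
    FI.mem (‖W (hcpShift + ξ)‖ ^ 2) (extFI E X (Sum.inr (Sum.inr 0))) := by
  have hF := mem_uF W hE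
  have hT := mem_uT W ξ hE hX
  refine ⟨fun i j => mem_dot3 (hF i) (hF j), fun i => mem_dot3 (hF i) hT, ?_⟩
  rw [← real_inner_self_eq_norm_sq]; exact mem_dot3 hT hT

/-- Data of the `U` block of an entry/shuffle box. -/
def entU (c w : (Fin 3 × Fin 3) ⊕ Fin 3 → ℤ) : Fin 3 × Fin 3 → FI := entryFI (fun ab => c (Sum.inl ab)) (fun ab => w (Sum.inl ab))

/-- Extended Gram intervals of `U`. -/
def extU (c w : (Fin 3 × Fin 3) ⊕ Fin 3 → ℤ) : (Fin 3 × Fin 3) ⊕ (Fin 3 ⊕ Fin 1) → FI := extFI (entU c w) (shufFI c w)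

/-- Extended Gram intervals of the deviation `V = U − λ·1`. -/
def extV (c w : (Fin 3 × Fin 3) ⊕ Fin 3 → ℤ) (L : ℤ) : (Fin 3 × Fin 3) ⊕ (Fin 3 ⊕ Fin 1) → FI :=
  extFI (devFI (fun ab => c (Sum.inl ab)) (fun ab => w (Sum.inl ab)) L) (shufFI c w)

/-- `‖nbrU k‖²` in the kernel. -/
def nbrSq (c w : (Fin 3 × Fin 3) ⊕ Fin 3 → ℤ) (k : Fin 12) : FI := qform13 (extU c w) (hlab k) (hshift k)

/-- `‖V (nbr k + s_k ξ)‖²` in the kernel. -/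
def devSqH (c w : (Fin 3 × Fin 3) ⊕ Fin 3 → ℤ) (L : ℤ) (k : Fin 12) : FI := qform13 (extV c w L) (hlab k) (hshift k)

/-- The twelve indices as a list. -/
def K12H : List (Fin 12) := [0, 1, 2, 3, 4, 5, 6, 7, 8, 9, 10, 11]

/-- Every index is listed. [formal bookkeeping] -/
theorem mem_K12H (k : Fin 12) : k ∈ K12H := by fin_cases k <;> decide

/-- Enclosure of `d² = min_k ‖nbrU k‖²`. -/
def dSqH (c w : (Fin 3 × Fin 3) ⊕ Fin 3 → ℤ) : FI := ⟨lmin (K12H.map fun k => (nbrSq c w k).lo), lmin (K12H.map fun k => (nbrSq c w k).hi)⟩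

/-- Enclosure of `d`. -/
def dEnclH (c w : (Fin 3 × Fin 3) ⊕ Fin 3 → ℤ) : FI := FI.sqrt (dSqH c w)

/-- `ρ²` (scaled): the largest upper end of `‖V(nbr k + s_k ξ)‖²`. -/
def devMaxH (c w : (Fin 3 × Fin 3) ⊕ Fin 3 → ℤ) (L : ℤ) : ℤ := lmax (K12H.map fun k => (devSqH c w L k).hi)

/-- `‖ξ‖²` in the kernel. -/
def xiSq (c w : (Fin 3 × Fin 3) ⊕ Fin 3 → ℤ) : FI := (((shufFI c w 0).sqr).add ((shufFI c w 1).sqr)).add ((shufFI c w 2).sqr)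

/-- The misfit bound `6ρ² + 12λ²‖ξ‖²` in the kernel. -/
def misfitH (c w : (Fin 3 × Fin 3) ⊕ Fin 3 → ℤ) (L : ℤ) : FI :=
  ((FI.ofScaled (devMaxH c w L)).mulInt 6).add ((((FI.ofScaled L).mul (FI.ofScaled L)).mul (xiSq c w)).mulInt 12)

/-- ★ **THE hcp (P1) FIT VERDICT on an entry/shuffle box.** -/
def fitOKH (c w : (Fin 3 × Fin 3) ⊕ Fin 3 → ℤ) : Bool :=
  let L := scaleL (fun ab => c (Sum.inl ab))
  let D := dEnclH c w
  decide (0 ≤ L) && decide (0 < D.lo) && decide (D.lo ≤ D.hi) && decide (2 * D.hi ≤ 3 * (SC : ℤ)) &&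
  decide ((SC : ℤ) ≤ 130 * D.lo) && decide (4 * (xiSq c w).hi ≤ (SC : ℤ)) &&
  decide (1000000 * (misfitH c w L).hi ≤ 2401 * (dSqH c w).lo) &&
  K12H.all (fun k => decide ((nbrSq c w k).hi * SC * 10000 ≤ (130 * D.lo - SC) ^ 2)) &&
  decide (∀ b ∈ box7all,
    (b = 0 ∨ (∃ k : Fin 12, hshift k = false ∧ hlab k = b) ∨ (130 * D.hi + (SC : ℤ)) ^ 2 ≤ (qform13 (extU c w) b false).lo * SC * 10000) ∧
    ((∃ k : Fin 12, hshift k = true ∧ hlab k = b) ∨ (130 * D.hi + (SC : ℤ)) ^ 2 ≤ (qform13 (extU c w) b true).lo * SC * 10000))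

end Summit.AtomisticToContinuum.Crystallization.Theorems.FrustratedLawDichotomyStrainedPatchHomEntryFitHcpKit
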